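import Mathlib.Geometry.Manifold.Instances.Real
import Literature.Geometry.Lorentzian.CauchyDevelopment
import HarnessLib

/-!
# Named fact: existence of the maximal globally hyperbolic vacuum development
# (Choquet-Bruhat–Geroch 1969, Theorem 3) over `VacuumCauchyDevelopment`

The corrected rendering of the MGHD existence theorem announced in the module docstring of
`Literature.Geometry.Lorentzian.CauchyProblem` (§ "Verdict clean-up", under the name
`choquetBruhat_geroch_exists_mghd_cauchy`): the deprecated `choquetBruhat_geroch_exists_mghd`
there ranges over the uninhabited prelude structure `VacuumDevelopment` and is refuted in
`CauchyProblemExistenceDefect`; the statement below is that one verbatim with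
`VacuumDevelopment ↦ VacuumCauchyDevelopment` (the repaired structure of `CauchyDevelopment.lean`,
whose Cauchy-surface field is O'Neill's `IsCauchyHypersurface` and which is inhabited by Minkowski
spacetime at the trivial data, `MinkowskiCauchyDevelopment`), with the manifold `X` bound INSIDE the
proposition so that the fact is a closed `Prop` usable as a hypothesis `(h : …)` by the routes of
summit `FinalStateConjecture` (their shared item `AdmissibleMGHDExists` is this fact restricted to
Christodoulou-admissible data, via `isVacuumConstraintSolution_of_mem_admissibleVacuumData` and the
instance `InitialDataSet.hasLeviCivita_ofRiemannian`).

What is printed (Choquet-Bruhat–Geroch, Commun. Math. Phys. 14 (1969) 329–335, Theorem 3, p. 332):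
"Let S be an initial data set. Then there exists a development M of S which is an extension of
every other development of S. This development is unique (up to isometry)." Here "initial data
set" = smooth `(Σ, h, K)` satisfying the vacuum constraints, "development" = globally hyperbolic
vacuum development in which `Σ` is a Cauchy surface (their footnote 5, p. 331), "extension" = the
other development embeds isometrically, compatibly with the embeddings of `Σ`. Modern proofs:
Sbierski, Ann. Henri Poincaré 17 (2016) 301 = arXiv:1309.7591v3, Thm. 2.8 (existence of the MGHD
without Zorn's lemma; Def. 2.2 GHD, Def. 2.3 extension, Def. 2.5/2.7 MGHD); Ringström, *The Cauchy
Problem in General Relativity* (EMS 2009), Thm. 16.6 with Defs. 16.3, 16.5. Only EXISTENCE is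
vendored here; uniqueness up to isometry over the repaired structure is
`VacuumCauchyDevelopment.isIsometricTo_of_isMaximal` (`CauchyProblemCauchy`, proved from
maximality of both).

Design notes. `X` connected, Hausdorff, second countable (the printed standing assumptions on `Σ`;
`VacuumCauchyDevelopment` requires `[ConnectedSpace X]`); dimension `3 + 1` as everywhere in this
directory (the printed theorem is dimension-independent); `[D.metric.HasLeviCivita]` is the standing
instance hypothesis of `InitialDataSet.IsVacuumConstraintSolution` (discharged for `(𝓡 3)` data by
`InitialDataSet.hasLeviCivita_ofRiemannian`). Maximality `VacuumCauchyDevelopment.IsMaximal`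
quantifies over developments with carrier in ONE universe (that of the development), as recorded in
`CauchyDevelopment.lean`; the printed theorem has no universe bookkeeping. No proof is possible in
the tree today (quasilinear hyperbolic existence theory in harmonic gauge, local geometric
uniqueness, gluing of developments — none has a carrier in Mathlib), hence a named fact (D-0014).
-/

noncomputable section

open scoped Manifold ContDiff

namespace Literature.Geometry.Lorentzian

/-- **Choquet-Bruhat–Geroch 1969, Theorem 3 (existence of the maximal globally hyperbolic vacuum
development), over the repaired structure `VacuumCauchyDevelopment`.** For every connected,
Hausdorff, second countable smooth `3`-manifold `X` and every smooth vacuum initial data set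
`D = (h, k)` on `X` solving the vacuum constraint equations there is a vacuum Cauchy development
`𝒟` of `D` (time-oriented Ricci-flat Lorentzian `4`-manifold with `X` embedded as a Cauchy
hypersurface inducing `(h, k)`) which is maximal: every vacuum Cauchy development of `D` embeds
isometrically into `𝒟`, compatibly with the embeddings of `X`. "Let S be an initial data set. Then
there exists a development M of S which is an extension of every other development of S."
This is the statement recorded as `choquetBruhat_geroch_exists_mghd_cauchy` in the module docstring
of `CauchyProblem.lean`, with `X` bound inside. Users take `(h : choquetBruhat_geroch_exists_mghd_cauchy)`; grounds
`Summit.FinalStateConjecture.FinalStateConjecture.Theses.ProbeNullTrace.AdmissibleMGHDExists`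
(item stmt-FinalStateConjecture-9937, shared by the routes of that summit) = this fact restricted to
`admissibleVacuumData X`.
[cite: ChoquetBruhatGeroch1969CMP, Thm. 3 (p. 332)] [cite: Sbierski2016AHP, Thm. 2.8]
[cite: Ringstrom2009, Thm. 16.6] -/
def choquetBruhat_geroch_exists_mghd_cauchy : Prop :=
  ∀ (X : Type) [TopologicalSpace X] [ChartedSpace (EuclideanSpace ℝ (Fin 3)) X]
    [IsManifold (𝓡 3) ∞ X] [T2Space X] [SecondCountableTopology X] [ConnectedSpace X]
    (D : InitialDataSet (𝓡 3) X) [D.metric.HasLeviCivita],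
    D.IsVacuumConstraintSolution → ∃ 𝒟 : VacuumCauchyDevelopment D, 𝒟.IsMaximal

end Literature.Geometry.Lorentzian

end
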